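/-
Copyright (c) 2026 the pub-hodgecm-mathlib formalisation cell (harness21).  Prover seat hodgecm-mathlib-F0P2-p06 (g13): road «S3-ram» (LEAD F0P3a-plan (g12); architect
A-p16 (g31); junction pen F0P3a-p01 (g17), J-PACK v2 ROW-O; owner F0P3a-p06 (g15)); 2026-09-02.
-/
import Literature.NumberTheory.Automorphic.UnitaryLatticeTreeFixedRowOddFrameRamified     -- p847542 (this seat): ROW-O at the frame `rowO_of_frame`
import Literature.NumberTheory.Automorphic.UnitaryLatticeTreeFixedRowEvenRamified         -- ★ p847526 (F0P2-p01): ROW-E (template), brings ★ M ∕ M₂ kernel files p847505 ∕ p847513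
import HarnessLib

/-!
# The lattice graph of a hermitian space — J-PACK v2 ROW-O «ODD REGULAR VERTEX `O_{m+1}`» in token currency (tamely ramified place): the socket `row_O` of the junction
# skeleton, closed from ★ `rowO_of_frame` by discharging the two kernel inputs from the ORIENTATION hypothesis `hup` (Kottwitz 1986 §3; Bruhat–Tits 1972 §10)

Topic `NumberTheory/Automorphic`; namespace `Literature.NumberTheory.Automorphic.UnitaryLatticeTree`.  THEOREMS ONLY (no definition, no instance, no notation, no named fact,
no `sorry`); kernel lane `--supports stmt-HodgeConjecture-24833`.  Cell `pub/hodgecm-mathlib` (D-0151), crux H413; road «S3-ram» (Literature seeding, count-neutral);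
J-PACK v2 (junction pen F0P3a-p01 (g17)) **ROW-O** — THE SOCKET TEXT `row_O` (skeleton v2 `JunctionSockets` :87, binder order verbatim; the count sets are the socket's
`{w | w ∈ GC v ∧ …}`).  PROOF = ★ ROW-E's orientation template (F0P2-p01) feeding ★ `rowO_of_frame` (this seat): `v = u·r₀` (★ transitivity); the INWARD frame `u₀ = uκ₀` of the
parent `p = (uκ₀)·N₁` (★ FILE L on `(v, p, g)`); `hup` at `g = latt(u₀·g(a₀,b₀))` ⇒ the inward line is an eigenline (★ J §1) hence — by residual nilpotency and ★ J's pivot —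
the whole first column of `Y₀ = u₀⁻¹γu₀ − 1` is `≡ 0 (ϖ^{d+1})`; the ODD SHAPE of `Y₀` (★ M: `Ȳ₀ = γ′(E₀₁ + E₁₂) + s·E₀₂`, `|γ′| = |ϖ|^d` from `¬LEV₂(ϖ^{2d+1})`) and the
KERNEL TEST (★ M₂ `forall_v_conj_apply_zero_le_succ_iff`: column 0 of `κ⁻¹Y₀κ` vanishes to order `d` iff `|κ₂₀| < 1` iff `κ·N₁ = N₁`, ★ K) give the frame-form inputs of
★ `rowO_of_frame`: the parent's line is `Q_Ȳ`-null, every other neighbour's line is off the kernel.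

HONEST LABEL: HC_CM is proved only modulo the 2 remaining named inputs (hLiu418 24832, h413 24833) until rung 0 closes; nothing printed is asserted here (bookkeeping over ★
results); «S3-ram» has no books consequence.

## References
* [Kottwitz1986] R. E. Kottwitz, *Base change for unit elements of Hecke algebras*, Compositio Math. 60 (1986), §3 (counting fixed lattices shell by shell).
* [BruhatTits1972] F. Bruhat, J. Tits, *Groupes réductifs sur un corps local I*, Publ. Math. IHÉS 41 (1972), §10 (lattice models; vertex stabilisers).
* [Tits1979] J. Tits, *Reductive groups over local fields*, PSPM 33.1 (1979), §3.5 (congruence filtration, reduction mod `𝔭`).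
* [Serre1980Trees] J.-P. Serre, *Trees* (1980), Ch. I §2.3, Ch. II §1.1 (rooted trees; neighbours of a lattice).
-/

set_option autoImplicit false

noncomputable section

open scoped Valued WithZero Matrix MatrixGroups

namespace Literature.NumberTheory.Automorphic.UnitaryLatticeTree

open Literature.NumberTheory.Automorphic Literature.NumberTheory.Automorphic.HermitianLattice
open Literature.NumberTheory.Automorphic.CartanUnique Literature.NumberTheory.Automorphic.UnitaryGroup

variable {K : Type*} [Field K] [Valued K ℤᵐ⁰] {σ : K →+* K} {ϖ : K}

/-- **ROW-O «ODD REGULAR VERTEX `O_{m+1}`» (J-PACK v2 §2, socket `row_O`)**: for a fixed self-dual vertex `v ≠ r₀` of odd depth `d ≥ 3` (`LEV[v](ϖ^d)`, `¬LEV[v](ϖ^{d+1})`),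
rank two (`¬LEV₂[v](ϖ^{2d+1})`), residually nilpotent (`LEV₃[v](ϖ^{3d+1})`), oriented (`p` inward, `g ≠ v` through `p` with `LEV[g](ϖ^d)`), and any unit `c`: every fixed
grandchild is `(d−1, rank 2)` or `(d−2, rank ≤ 1)`; `#{(d−1)} = q`; `#{(d−2) ∧ CLS c} = q.choose 2 = #{(d−2) ∧ ¬CLS c}`. [cite: Kottwitz1986, §3] [cite: BruhatTits1972, §10]
[cite: Tits1979, §3.5] [cite: Serre1980Trees, I.2.3] -/
theorem fixedGrandchildren_tokens_and_ncard_of_odd (hσ : ∀ x, σ (σ x) = x) (hvσ : ∀ a, Valued.v (σ a) = Valued.v a) (hσϖ : σ ϖ = -ϖ)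
    (hϖ : Valued.v ϖ = WithZero.exp (-1 : ℤ)) (hres : ∀ x : K, Valued.v x ≤ 1 → Valued.v (σ x - x) < 1) (h2 : Valued.v (2 : K) = 1) [Finite 𝓀[K]]
    (hT : (latticeGraph σ ϖ ((StdForm.antidiagonal 3).over K)).IsTree)
    {γ : unitaryGroupOfForm σ ((StdForm.antidiagonal 3).over K)} (_hγ0 : γ ∈ unitaryInt σ ((StdForm.antidiagonal 3).over K))
    {v : {M : Submodule 𝒪[K] (Fin 3 → K) // IsVertex σ ϖ ((StdForm.antidiagonal 3).over K) M}}
    (hv : IsSelfDualLattice σ ϖ ((StdForm.antidiagonal 3).over K) v.1) (hvr : v ≠ ⟨stdLattice K 3, 0, isSelfDualLattice_stdLattice_three_of_v hϖ⟩)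
    (hfix : latticeGraphIso σ ϖ ((StdForm.antidiagonal 3).over K) γ v = v)
    {d : ℕ} (hd3 : 3 ≤ d) (hdo : Odd d)
    {p g : {M : Submodule 𝒪[K] (Fin 3 → K) // IsVertex σ ϖ ((StdForm.antidiagonal 3).over K) M}}
    (hp : (latticeGraph σ ϖ ((StdForm.antidiagonal 3).over K)).Adj v p) (hpin : (latticeGraph σ ϖ ((StdForm.antidiagonal 3).over K)).dist ⟨stdLattice K 3, 0, isSelfDualLattice_stdLattice_three_of_v hϖ⟩ p + 1 = (latticeGraph σ ϖ ((StdForm.antidiagonal 3).over K)).dist ⟨stdLattice K 3, 0, isSelfDualLattice_stdLattice_three_of_v hϖ⟩ v) (hg : (latticeGraph σ ϖ ((StdForm.antidiagonal 3).over K)).Adj p g) (hgv : g ≠ v)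
    (hup : g.1.map ((Matrix.toLin' (((γ : GL (Fin 3) K) : Matrix (Fin 3) (Fin 3) K) - 1)).restrictScalars 𝒪[K]) ≤ scaleLattice (ϖ ^ d) g.1)
    (hlev : v.1.map ((Matrix.toLin' (((γ : GL (Fin 3) K) : Matrix (Fin 3) (Fin 3) K) - 1)).restrictScalars 𝒪[K]) ≤ scaleLattice (ϖ ^ d) v.1) (_hlev' : ¬ v.1.map ((Matrix.toLin' (((γ : GL (Fin 3) K) : Matrix (Fin 3) (Fin 3) K) - 1)).restrictScalars 𝒪[K]) ≤ scaleLattice (ϖ ^ (d + 1)) v.1) (hrk : ¬ v.1.map ((Matrix.toLin' ((((γ : GL (Fin 3) K) : Matrix (Fin 3) (Fin 3) K) - 1) ^ 2)).restrictScalars 𝒪[K]) ≤ scaleLattice (ϖ ^ (2 * d + 1)) v.1) (hnil : v.1.map ((Matrix.toLin' ((((γ : GL (Fin 3) K) : Matrix (Fin 3) (Fin 3) K) - 1) ^ 3)).restrictScalars 𝒪[K]) ≤ scaleLattice (ϖ ^ (3 * d + 1)) v.1)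
    (c : K) (hc : Valued.v c = 1) :
    (∀ w ∈ {w | ∃ c, ((latticeGraph σ ϖ ((StdForm.antidiagonal 3).over K)).Adj v c ∧ (latticeGraph σ ϖ ((StdForm.antidiagonal 3).over K)).dist ⟨stdLattice K 3, 0, isSelfDualLattice_stdLattice_three_of_v hϖ⟩ c = (latticeGraph σ ϖ ((StdForm.antidiagonal 3).over K)).dist ⟨stdLattice K 3, 0, isSelfDualLattice_stdLattice_three_of_v hϖ⟩ v + 1 ∧ latticeGraphIso σ ϖ ((StdForm.antidiagonal 3).over K) γ c = c) ∧ ((latticeGraph σ ϖ ((StdForm.antidiagonal 3).over K)).Adj c w ∧ (latticeGraph σ ϖ ((StdForm.antidiagonal 3).over K)).dist ⟨stdLattice K 3, 0, isSelfDualLattice_stdLattice_three_of_v hϖ⟩ w = (latticeGraph σ ϖ ((StdForm.antidiagonal 3).over K)).dist ⟨stdLattice K 3, 0, isSelfDualLattice_stdLattice_three_of_v hϖ⟩ c + 1 ∧ latticeGraphIso σ ϖ ((StdForm.antidiagonal 3).over K) γ w = w)},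
        (w.1.map ((Matrix.toLin' (((γ : GL (Fin 3) K) : Matrix (Fin 3) (Fin 3) K) - 1)).restrictScalars 𝒪[K]) ≤ scaleLattice (ϖ ^ (d - 1)) w.1 ∧ ¬ w.1.map ((Matrix.toLin' (((γ : GL (Fin 3) K) : Matrix (Fin 3) (Fin 3) K) - 1)).restrictScalars 𝒪[K]) ≤ scaleLattice (ϖ ^ d) w.1 ∧ ¬ w.1.map ((Matrix.toLin' ((((γ : GL (Fin 3) K) : Matrix (Fin 3) (Fin 3) K) - 1) ^ 2)).restrictScalars 𝒪[K]) ≤ scaleLattice (ϖ ^ (2 * d - 1)) w.1) ∨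
        (w.1.map ((Matrix.toLin' (((γ : GL (Fin 3) K) : Matrix (Fin 3) (Fin 3) K) - 1)).restrictScalars 𝒪[K]) ≤ scaleLattice (ϖ ^ (d - 2)) w.1 ∧ ¬ w.1.map ((Matrix.toLin' (((γ : GL (Fin 3) K) : Matrix (Fin 3) (Fin 3) K) - 1)).restrictScalars 𝒪[K]) ≤ scaleLattice (ϖ ^ (d - 1)) w.1 ∧ w.1.map ((Matrix.toLin' ((((γ : GL (Fin 3) K) : Matrix (Fin 3) (Fin 3) K) - 1) ^ 2)).restrictScalars 𝒪[K]) ≤ scaleLattice (ϖ ^ (2 * d - 3)) w.1)) ∧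
      ({w | w ∈ {w | ∃ c, ((latticeGraph σ ϖ ((StdForm.antidiagonal 3).over K)).Adj v c ∧ (latticeGraph σ ϖ ((StdForm.antidiagonal 3).over K)).dist ⟨stdLattice K 3, 0, isSelfDualLattice_stdLattice_three_of_v hϖ⟩ c = (latticeGraph σ ϖ ((StdForm.antidiagonal 3).over K)).dist ⟨stdLattice K 3, 0, isSelfDualLattice_stdLattice_three_of_v hϖ⟩ v + 1 ∧ latticeGraphIso σ ϖ ((StdForm.antidiagonal 3).over K) γ c = c) ∧ ((latticeGraph σ ϖ ((StdForm.antidiagonal 3).over K)).Adj c w ∧ (latticeGraph σ ϖ ((StdForm.antidiagonal 3).over K)).dist ⟨stdLattice K 3, 0, isSelfDualLattice_stdLattice_three_of_v hϖ⟩ w = (latticeGraph σ ϖ ((StdForm.antidiagonal 3).over K)).dist ⟨stdLattice K 3, 0, isSelfDualLattice_stdLattice_three_of_v hϖ⟩ c + 1 ∧ latticeGraphIso σ ϖ ((StdForm.antidiagonal 3).over K) γ w = w)} ∧ (w.1.map ((Matrix.toLin' (((γ : GL (Fin 3) K) : Matrix (Fin 3) (Fin 3) K) - 1)).restrictScalars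 𝒪[K]) ≤ scaleLattice (ϖ ^ (d - 1)) w.1 ∧ ¬ w.1.map ((Matrix.toLin' (((γ : GL (Fin 3) K) : Matrix (Fin 3) (Fin 3) K) - 1)).restrictScalars 𝒪[K]) ≤ scaleLattice (ϖ ^ d) w.1)}).ncard = Nat.card 𝓀[K] ∧
      ({w | w ∈ {w | ∃ c, ((latticeGraph σ ϖ ((StdForm.antidiagonal 3).over K)).Adj v c ∧ (latticeGraph σ ϖ ((StdForm.antidiagonal 3).over K)).dist ⟨stdLattice K 3, 0, isSelfDualLattice_stdLattice_three_of_v hϖ⟩ c = (latticeGraph σ ϖ ((StdForm.antidiagonal 3).over K)).dist ⟨stdLattice K 3, 0, isSelfDualLattice_stdLattice_three_of_v hϖ⟩ v + 1 ∧ latticeGraphIso σ ϖ ((StdForm.antidiagonal 3).over K) γ c = c) ∧ ((latticeGraph σ ϖ ((StdForm.antidiagonal 3).over K)).Adj c w ∧ (latticeGraph σ ϖ ((StdForm.antidiagonal 3).over K)).dist ⟨stdLattice K 3, 0, isSelfDualLattice_stdLattice_three_of_v hϖ⟩ w = (latticeGraph σ ϖ ((StdForm.antidiagonal 3).over K)).dist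 ⟨stdLattice K 3, 0, isSelfDualLattice_stdLattice_three_of_v hϖ⟩ c + 1 ∧ latticeGraphIso σ ϖ ((StdForm.antidiagonal 3).over K) γ w = w)} ∧ ((w.1.map ((Matrix.toLin' (((γ : GL (Fin 3) K) : Matrix (Fin 3) (Fin 3) K) - 1)).restrictScalars 𝒪[K]) ≤ scaleLattice (ϖ ^ (d - 2)) w.1 ∧ ¬ w.1.map ((Matrix.toLin' (((γ : GL (Fin 3) K) : Matrix (Fin 3) (Fin 3) K) - 1)).restrictScalars 𝒪[K]) ≤ scaleLattice (ϖ ^ (d - 1)) w.1) ∧ (∃ y ∈ w.1, ∃ a : K, Valued.v a = 1 ∧ Valued.v ((ϖ ^ (d - 2))⁻¹ * pairing σ ((StdForm.antidiagonal 3).over K) y ((((γ : GL (Fin 3) K) : Matrix (Fin 3) (Fin 3) K) - 1) *ᵥ y) - (c) * a ^ 2) < 1))}).ncard = (Nat.card 𝓀[K]).choose 2 ∧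
      ({w | w ∈ {w | ∃ c, ((latticeGraph σ ϖ ((StdForm.antidiagonal 3).over K)).Adj v c ∧ (latticeGraph σ ϖ ((StdForm.antidiagonal 3).over K)).dist ⟨stdLattice K 3, 0, isSelfDualLattice_stdLattice_three_of_v hϖ⟩ c = (latticeGraph σ ϖ ((StdForm.antidiagonal 3).over K)).dist ⟨stdLattice K 3, 0, isSelfDualLattice_stdLattice_three_of_v hϖ⟩ v + 1 ∧ latticeGraphIso σ ϖ ((StdForm.antidiagonal 3).over K) γ c = c) ∧ ((latticeGraph σ ϖ ((StdForm.antidiagonal 3).over K)).Adj c w ∧ (latticeGraph σ ϖ ((StdForm.antidiagonal 3).over K)).dist ⟨stdLattice K 3, 0, isSelfDualLattice_stdLattice_three_of_v hϖ⟩ w = (latticeGraph σ ϖ ((StdForm.antidiagonal 3).over K)).dist ⟨stdLattice K 3, 0, isSelfDualLattice_stdLattice_three_of_v hϖ⟩ c + 1 ∧ latticeGraphIso σ ϖ ((StdForm.antidiagonal 3).over K) γ w = w)} ∧ ((w.1.map ((Matrix.toLin' (((γ : GL (Fin 3) K) : Matrix (Fin 3) (Fin 3) K) - 1)).restrictScalars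 𝒪[K]) ≤ scaleLattice (ϖ ^ (d - 2)) w.1 ∧ ¬ w.1.map ((Matrix.toLin' (((γ : GL (Fin 3) K) : Matrix (Fin 3) (Fin 3) K) - 1)).restrictScalars 𝒪[K]) ≤ scaleLattice (ϖ ^ (d - 1)) w.1) ∧ ¬ (∃ y ∈ w.1, ∃ a : K, Valued.v a = 1 ∧ Valued.v ((ϖ ^ (d - 2))⁻¹ * pairing σ ((StdForm.antidiagonal 3).over K) y ((((γ : GL (Fin 3) K) : Matrix (Fin 3) (Fin 3) K) - 1) *ᵥ y) - (c) * a ^ 2) < 1))}).ncard = (Nat.card 𝓀[K]).choose 2 := by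
  have hϖ0 : ϖ ≠ 0 := fun h0 => by rw [h0, map_zero] at hϖ; exact WithZero.coe_ne_zero hϖ.symm
  have hvϖ0 : Valued.v ϖ ≠ 0 := (Valuation.ne_zero_iff _).2 hϖ0
  have hϖlt : Valued.v ϖ < 1 := by rw [hϖ, ← WithZero.exp_zero]; exact WithZero.exp_lt_exp.2 (by norm_num)
  have hd1 : 1 ≤ d := by omega
  -- ### the frame of `v`, adapted to the INWARD neighbour: `v = u·r₀ = u₀·r₀`, `p = u₀·N₁`, `g = latt(u₀·g(a₀,b₀))`
  obtain ⟨u, hu⟩ := exists_latticeGraphIso_root_eq_of_v_two hσ hvσ hϖ h2 v hv (isSelfDualLattice_stdLattice_three_of_v hϖ)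
  subst hu
  obtain ⟨κ₀, hκ₀, a₀, b₀, ha₀, hb₀, hp_eq, hg_eq⟩ := exists_frame_of_adj_adj hσ hvσ hσϖ hϖ hres h2 u rfl hp hg hgv
  set u₀ : unitaryGroupOfForm σ ((StdForm.antidiagonal 3).over K) := u * κ₀ with hu₀def
  have hv₀ : latticeGraphIso σ ϖ ((StdForm.antidiagonal 3).over K) u₀ ⟨stdLattice K 3, 0, isSelfDualLattice_stdLattice_three_of_v hϖ⟩ = latticeGraphIso σ ϖ ((StdForm.antidiagonal 3).over K) u ⟨stdLattice K 3, 0, isSelfDualLattice_stdLattice_three_of_v hϖ⟩ := by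
    rw [hu₀def, latticeGraphIso_mul_apply, latticeGraphIso_root_eq_of_mem_unitaryInt hϖ hκ₀]
  -- tokens ↔ matrices in the frame `u₀` (★ G3⁵), powers 1, 2, 3
  set γ₀ : unitaryGroupOfForm σ ((StdForm.antidiagonal 3).over K) := u₀⁻¹ * γ * u₀ with hγ₀def
  have hY₀ : ∀ i j, Valued.v ((((γ₀ : GL (Fin 3) K) : Matrix (Fin 3) (Fin 3) K) - 1) i j) ≤ Valued.v ϖ ^ d := by
    have h := (map_pow_le_scaleLattice_latticeGraphIso_root_iff hϖ γ u₀ (pow_ne_zero d hϖ0) 1).1 (by rw [pow_one, hv₀]; exact hlev)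
    simpa only [pow_one, map_pow] using h
  have hY₀3 : ∀ i j, Valued.v (((((γ₀ : GL (Fin 3) K) : Matrix (Fin 3) (Fin 3) K) - 1) * (((γ₀ : GL (Fin 3) K) : Matrix (Fin 3) (Fin 3) K) - 1) * (((γ₀ : GL (Fin 3) K) : Matrix (Fin 3) (Fin 3) K) - 1)) i j) ≤ Valued.v ϖ ^ (3 * d + 1) := by
    have h := (map_pow_le_scaleLattice_latticeGraphIso_root_iff hϖ γ u₀ (pow_ne_zero _ hϖ0) 3).1 (by rw [hv₀]; exact hnil)
    simpa only [pow_three', map_pow] using h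
  have hY₀2 : ¬ ∀ i j, Valued.v (((((γ₀ : GL (Fin 3) K) : Matrix (Fin 3) (Fin 3) K) - 1) * (((γ₀ : GL (Fin 3) K) : Matrix (Fin 3) (Fin 3) K) - 1)) i j) ≤ Valued.v ϖ ^ (2 * d + 1) := by
    intro h
    apply hrk
    have h' := (map_pow_le_scaleLattice_latticeGraphIso_root_iff hϖ γ u₀ (pow_ne_zero (2 * d + 1) hϖ0) 2).2 (by simpa only [pow_two, map_pow] using h)
    rwa [hv₀] at h'
  have hM₀ : (((γ₀ : GL (Fin 3) K) : Matrix (Fin 3) (Fin 3) K) - 1) = ((((u₀ : unitaryGroupOfForm σ ((StdForm.antidiagonal 3).over K)) : GL (Fin 3) K)⁻¹ : GL (Fin 3) K) : Matrix (Fin 3) (Fin 3) K) * (((γ : GL (Fin 3) K) : Matrix (Fin 3) (Fin 3) K) - 1) * (((u₀ : unitaryGroupOfForm σ ((StdForm.antidiagonal 3).over K)) : GL (Fin 3) K) : Matrix (Fin 3) (Fin 3) K) :=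
    coe_inv_mul_mul_sub_one γ u₀
  -- ### the inward line is in the kernel: column 0 of `Y₀` is `≡ 0 (ϖ^(d+1))` (★ J §1 from `hup`, ★ J pivot + nilpotency for the rest)
  have hcol₀ : ∀ i, Valued.v ((((γ₀ : GL (Fin 3) K) : Matrix (Fin 3) (Fin 3) K) - 1) i 0) ≤ Valued.v ϖ ^ (d + 1) := by
    have hup' := hup
    rw [hg_eq] at hup'
    have hM₀' : ∀ i j, Valued.v ((((((u * κ₀ : unitaryGroupOfForm σ ((StdForm.antidiagonal 3).over K)) : GL (Fin 3) K)⁻¹ : GL (Fin 3) K) : Matrix (Fin 3) (Fin 3) K) * (((γ : GL (Fin 3) K) : Matrix (Fin 3) (Fin 3) K) - 1) *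
        (((u * κ₀ : unitaryGroupOfForm σ ((StdForm.antidiagonal 3).over K)) : GL (Fin 3) K) : Matrix (Fin 3) (Fin 3) K)) i j) ≤ Valued.v ϖ ^ d := fun i j => by rw [← hu₀def, ← hM₀]; exact hY₀ i j
    obtain ⟨h10, -, h20⟩ := v_apply_le_succ_of_map_sub_one_childLatt_le hϖ ((u * κ₀ : unitaryGroupOfForm σ ((StdForm.antidiagonal 3).over K)) : GL (Fin 3) K) (γ : GL (Fin 3) K) ha₀ hb₀ hd1 hM₀' hup'
    have hcube' : ∀ i j, Valued.v (((((((u * κ₀ : unitaryGroupOfForm σ ((StdForm.antidiagonal 3).over K)) : GL (Fin 3) K)⁻¹ : GL (Fin 3) K) : Matrix (Fin 3) (Fin 3) K) * (((γ : GL (Fin 3) K) : Matrix (Fin 3) (Fin 3) K) - 1) * (((u * κ₀ : unitaryGroupOfForm σ ((StdForm.antidiagonal 3).over K)) : GL (Fin 3) K) : Matrix (Fin 3) (Fin 3) K)) *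
        (((((u * κ₀ : unitaryGroupOfForm σ ((StdForm.antidiagonal 3).over K)) : GL (Fin 3) K)⁻¹ : GL (Fin 3) K) : Matrix (Fin 3) (Fin 3) K) * (((γ : GL (Fin 3) K) : Matrix (Fin 3) (Fin 3) K) - 1) * (((u * κ₀ : unitaryGroupOfForm σ ((StdForm.antidiagonal 3).over K)) : GL (Fin 3) K) : Matrix (Fin 3) (Fin 3) K)) *
        (((((u * κ₀ : unitaryGroupOfForm σ ((StdForm.antidiagonal 3).over K)) : GL (Fin 3) K)⁻¹ : GL (Fin 3) K) : Matrix (Fin 3) (Fin 3) K) * (((γ : GL (Fin 3) K) : Matrix (Fin 3) (Fin 3) K) - 1) * (((u * κ₀ : unitaryGroupOfForm σ ((StdForm.antidiagonal 3).over K)) : GL (Fin 3) K) : Matrix (Fin 3) (Fin 3) K))) i j) ≤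
        Valued.v ϖ ^ (3 * d + 1) := fun i j => by rw [← hu₀def, ← hM₀]; exact hY₀3 i j
    have hall : ∀ i, Valued.v ((((((u * κ₀ : unitaryGroupOfForm σ ((StdForm.antidiagonal 3).over K)) : GL (Fin 3) K)⁻¹ : GL (Fin 3) K) : Matrix (Fin 3) (Fin 3) K) * (((γ : GL (Fin 3) K) : Matrix (Fin 3) (Fin 3) K) - 1) *
        (((u * κ₀ : unitaryGroupOfForm σ ((StdForm.antidiagonal 3).over K)) : GL (Fin 3) K) : Matrix (Fin 3) (Fin 3) K)) i 0) ≤ Valued.v ϖ ^ (d + 1) := by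
      by_contra hnot
      have hpiv := v_one_zero_eq_of_cube_le_of_corner hϖ hM₀' hcube' h20 hnot
      have hlt : Valued.v ϖ ^ (d + 1) < Valued.v ϖ ^ d := by
        rw [pow_succ]; exact mul_lt_of_lt_one_right (zero_lt_iff.2 (pow_ne_zero _ hvϖ0)) hϖlt
      exact (lt_irrefl _) ((h10.trans_lt hlt).trans_eq hpiv.symm)
    intro i; rw [hM₀, hu₀def]; exact hall i
  -- ### the ODD SHAPE of `Y₀` (★ M) and the kernel test (★ M₂)
  obtain ⟨hshape, -⟩ := forall_v_coe_sub_one_le_succ_of_odd_of_col hvσ hσϖ hϖ hres γ₀ hdo hY₀ hcol₀ hY₀3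
  obtain ⟨h12, h01⟩ := v_coe_sub_one_one_two_eq_of_odd_of_col_of_sq hvσ hσϖ hϖ hres γ₀ hdo hY₀ hcol₀ hY₀3 hY₀2
  have hkernel : ∀ κ : unitaryGroupOfForm σ ((StdForm.antidiagonal 3).over K), κ ∈ unitaryInt σ ((StdForm.antidiagonal 3).over K) →
      ((∀ i, Valued.v ((((((u₀ * κ : unitaryGroupOfForm σ ((StdForm.antidiagonal 3).over K)) : GL (Fin 3) K)⁻¹ : GL (Fin 3) K) : Matrix (Fin 3) (Fin 3) K) * (((γ : GL (Fin 3) K) : Matrix (Fin 3) (Fin 3) K) - 1) * (((u₀ * κ : unitaryGroupOfForm σ ((StdForm.antidiagonal 3).over K)) : GL (Fin 3) K) : Matrix (Fin 3) (Fin 3) K)) i 0) ≤ Valued.v ϖ ^ (d + 1)) ↔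
        latticeGraphIso σ ϖ ((StdForm.antidiagonal 3).over K) (u₀ * κ) ⟨latt (Matrix.diagonal ![(1 : K), 1, ϖ]), 2, isVertexLattice_two_N₁_of_neg hσϖ hϖ⟩ = p) := by
    intro κ hκ
    have hMk : ((((u₀ * κ : unitaryGroupOfForm σ ((StdForm.antidiagonal 3).over K)) : GL (Fin 3) K)⁻¹ : GL (Fin 3) K) : Matrix (Fin 3) (Fin 3) K) * (((γ : GL (Fin 3) K) : Matrix (Fin 3) (Fin 3) K) - 1) * (((u₀ * κ : unitaryGroupOfForm σ ((StdForm.antidiagonal 3).over K)) : GL (Fin 3) K) : Matrix (Fin 3) (Fin 3) K) = (((κ : GL (Fin 3) K)⁻¹ : GL (Fin 3) K) : Matrix (Fin 3) (Fin 3) K) * (((γ₀ : GL (Fin 3) K) : Matrix (Fin 3) (Fin 3) K) - 1) * ((κ : GL (Fin 3) K) : Matrix (Fin 3) (Fin 3) K) := by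
      rw [← coe_inv_mul_mul_sub_one γ (u₀ * κ), ← coe_inv_mul_mul_sub_one γ₀ κ, hγ₀def, conj_mul_eq_inv_mul_conj_mul γ u₀ κ]
    rw [hMk, forall_v_conj_apply_zero_le_succ_iff hvσ hϖ hY₀ hshape h12 h01 hκ, ← mapGL_N₁_eq_iff_v_apply_two_zero_lt_one hvσ hϖ hκ, hp_eq,
      latticeGraphIso_mul_apply]
    constructor
    · intro h; congr 1; exact Subtype.ext (by rw [latticeGraphIso_apply_val]; exact h)
    · intro h
      have h' := congrArg Subtype.val ((latticeGraphIso σ ϖ ((StdForm.antidiagonal 3).over K) u₀).injective h)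
      rw [latticeGraphIso_apply_val] at h'
      exact h'
  -- ### feed ★ `rowO_of_frame` in the frame `u₀`
  have hmain := rowO_of_frame hσ hvσ hσϖ hϖ hres h2 hT u₀ (by rw [hv₀]; exact hvr) (by rw [hv₀]; exact hfix) hdo hd3
    (by rw [hv₀]; exact hlev) (by rw [hv₀]; exact hrk) (by rw [hv₀]; exact hnil) c hc p (by rw [hv₀]; exact hp) (by rw [hv₀]; exact hpin)
    (fun κ hκ hpκ => ((hkernel κ hκ).2 hpκ.symm) 2) (fun κ hκ hne hall => hne ((hkernel κ hκ).1 hall))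
  rw [hv₀] at hmain
  exact hmain

end Literature.NumberTheory.Automorphic.UnitaryLatticeTree

end
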